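import Summits.QuantumFields.YangMills.Theorems.TubeZeroFreeChannel.Negative.AxisBlocking

/-!
# `TubeZeroFreeChannel` — negative-side support III: kill criteria (accumulation points, sealed walls)

Support file for the crux `stmt-QuantumFields-18841` (`ComplexCouplingChannel.TubeZeroFreeChannel`),
extracted from the disprover's work file `Cruxes/TubeZeroFreeChannel/Disproof.lean` (§2) and from the
strategist's census sketch (`Cruxes/TubeZeroFreeChannel/StrategistSketch.lean`, whose
`not_tubeZeroFreeChannel_of_sealedWall` is re-proved here over the landed `boxZ`). Pure topology and
logic, everything proved, no definitions (the two notions below are spelled out in the hypotheses):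

* ACCUMULATION POINT of tube zeros at `z` (cofinal in `L`, then in `t` — the negation pattern of the crux's
  uniform zero-freeness, localised):
  `∀ ε > 0, ∀ L₀, ∃ L ≥ L₀, ∀ t₀, ∃ t ≥ t₀, ∃ w, dist w z < ε ∧ boxZ r w L t = 0`;
* SEALED WALL for `(G, r)` (strategist): an open `R ⊂ ℂ` containing all large real couplings, whose closure
  misses all small real couplings, every frontier point of which is an accumulation point.

Results: `not_zeroFree_of_accPt` (an open set containing an accumulation point is not uniformly
zero-free); `not_tubeZeroFreeChannel_of_blockedChannels` (if at ONE admissible `(G, r)`, for arbitrarily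
large `β` and some `ρ > 0`, every open connected `D ∋ β` with a real point `|x| < ρ` contains an
accumulation point, the crux is false — what an LLR Fisher-zero scan or a complex Pirogov–Sinai argument
would have to deliver); `exists_mem_frontier_of_isConnected` + `not_tubeZeroFreeChannel_of_sealedWall`
(a sealed wall at one admissible `(G, r)` refutes the crux); `not_crossoverBridge_of_sealedWall` (the same
wall kills the lead's stub `stub_crossoverBridge` of line `Sketch` — the bridge is the crux's hard core;
the corridor stub `stub_constantWidthStrip` is untouched by walls, its `β_c` being existential).
Candidate sealed wall (NOT proved; `Disproof.lean` §5): `(SU(2), (4·𝟙 ⊕ V ⊕ V̄)^{⊗p})`, `p ≫ 1`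
(van Enter–Shlosman CMP 255 (2005) Thm 2 + the large-`q` Potts picture of a non-closing coexistence wall).
-/

noncomputable section

open Filter Set Metric Topology
open Literature.MathematicalPhysics.QuantumFieldTheory
open Summit.QuantumFields.YangMills.Theses.ComplexCouplingChannel (TubeZeroFreeChannel)

namespace Summit.QuantumFields.YangMills.Theorems.TubeZeroFreeChannel.Negative

variable {G : Type} [Group G] [TopologicalSpace G] [IsTopologicalGroup G] [CompactSpace G]
  [MeasurableSpace G] [BorelSpace G]

/-- An open set containing a cofinal accumulation point of tube zeros is not uniformly zero-free.
[folklore] -/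
theorem not_zeroFree_of_accPt (r : LatticeRep G) {D : Set ℂ} (hD : IsOpen D) {z : ℂ} (hz : z ∈ D)
    (hacc : ∀ ε : ℝ, 0 < ε → ∀ L₀ : ℕ, ∃ L : ℕ, L₀ ≤ L ∧ ∀ t₀ : ℕ, ∃ t : ℕ, t₀ ≤ t ∧
      ∃ w : ℂ, dist w z < ε ∧ boxZ r w L t = 0) :
    ¬ ∃ L₀ : ℕ, ∀ L : ℕ, L₀ ≤ L → ∃ t₀ : ℕ, ∀ t : ℕ, t₀ ≤ t → ∀ w ∈ D, boxZ r w L t ≠ 0 := by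
  rintro ⟨L₀, hL₀⟩
  obtain ⟨ε, hε, hball⟩ := Metric.isOpen_iff.mp hD z hz
  obtain ⟨L, hL, hLt⟩ := hacc ε hε L₀
  obtain ⟨t₀, ht₀⟩ := hL₀ L hL
  obtain ⟨t, ht, w, hw, hZ⟩ := hLt t₀
  exact ht₀ t ht w (hball (Metric.mem_ball.mpr hw)) hZ

/-- **Kill criterion, accumulation form.** If at some admissible `(G, r)`, for arbitrarily large `β` and
some `ρ > 0`, EVERY open connected `D ∋ β` with a real point `|x| < ρ` contains a cofinal accumulation
point of tube zeros, then `TubeZeroFreeChannel` is false. [folklore] -/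
theorem not_tubeZeroFreeChannel_of_blockedChannels (hG : IsCompactSimpleLieGroup G) (r : LatticeRep G)
    (h : ∀ β₁ : ℝ, ∃ β : ℝ, β₁ ≤ β ∧ ∃ ρ : ℝ, 0 < ρ ∧ ∀ D : Set ℂ, IsOpen D → IsConnected D →
      (β : ℂ) ∈ D → (∃ x : ℝ, |x| < ρ ∧ (x : ℂ) ∈ D) → ∃ z ∈ D,
        ∀ ε : ℝ, 0 < ε → ∀ L₀ : ℕ, ∃ L : ℕ, L₀ ≤ L ∧ ∀ t₀ : ℕ, ∃ t : ℕ, t₀ ≤ t ∧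
          ∃ w : ℂ, dist w z < ε ∧ boxZ r w L t = 0) :
    ¬ TubeZeroFreeChannel := by
  intro hT
  obtain ⟨β₁, hβ₁⟩ := (tubeZeroFreeChannel_iff_boxZ.mp hT) G hG r
  obtain ⟨β, hβ, ρ, hρ, hblk⟩ := h β₁
  obtain ⟨D, hDo, hDc, hβD, hx, hzf⟩ := hβ₁ β hβ ρ hρ
  obtain ⟨z, hzD, hacc⟩ := hblk D hDo hDc hβD hx
  exact not_zeroFree_of_accPt r hDo hzD hacc hzf

/-- An open connected set through a point of an open `R` and a point outside `closure R` meets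
`frontier R` (`IsPreconnected.subset_of_closure_inter_subset`). [folklore] -/
theorem exists_mem_frontier_of_isConnected {R D : Set ℂ} (hRo : IsOpen R) (hDc : IsConnected D)
    {p q : ℂ} (hp : p ∈ D) (hpR : p ∈ R) (hq : q ∈ D) (hqR : q ∉ closure R) :
    ∃ w ∈ D, w ∈ frontier R := by
  have hnot : ¬ (closure R ∩ D ⊆ R) := fun hsub =>
    hqR (subset_closure (hDc.isPreconnected.subset_of_closure_inter_subset hRo ⟨_, hp, hpR⟩ hsub hq))
  obtain ⟨w, ⟨hwc, hwD⟩, hwR⟩ := Set.not_subset.mp hnot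
  exact ⟨w, hwD, hwc, by rwa [hRo.interior_eq]⟩

/-- **Kill criterion, sealed-wall form** (the strategist's `not_tubeZeroFreeChannel_of_sealedWall`): an
open `R` containing every real coupling `≥ b`, whose closure misses every real `|x| < ρ`, and whose
frontier consists of cofinal accumulation points of tube zeros of ONE admissible `(G, r)`, refutes the
crux (a connected open `D` through `β ∈ R` and `x ∉ closure R` meets `frontier R`). [folklore] -/
theorem not_tubeZeroFreeChannel_of_sealedWall (hG : IsCompactSimpleLieGroup G) (r : LatticeRep G)
    {R : Set ℂ} (hRo : IsOpen R) {b : ℝ} (hb : ∀ β : ℝ, b ≤ β → (β : ℂ) ∈ R) {ρ : ℝ} (hρ : 0 < ρ)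
    (hx : ∀ x : ℝ, |x| < ρ → (x : ℂ) ∉ closure R)
    (hW : ∀ z ∈ frontier R, ∀ ε : ℝ, 0 < ε → ∀ L₀ : ℕ, ∃ L : ℕ, L₀ ≤ L ∧ ∀ t₀ : ℕ, ∃ t : ℕ,
      t₀ ≤ t ∧ ∃ w : ℂ, dist w z < ε ∧ boxZ r w L t = 0) :
    ¬ TubeZeroFreeChannel := by
  refine not_tubeZeroFreeChannel_of_blockedChannels hG r fun β₁ => ⟨max β₁ b, le_max_left _ _, ρ, hρ, ?_⟩
  intro D hDo hDc hβD ⟨x, hxρ, hxD⟩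
  obtain ⟨w, hwD, hwf⟩ :=
    exists_mem_frontier_of_isConnected hRo hDc hβD (hb _ (le_max_right _ _)) hxD (hx x hxρ)
  exact ⟨w, hwD, hW w hwf⟩

/-- **Stub kill criterion**: the same sealed wall kills the lead's `stub_crossoverBridge` of line `Sketch`
(the strategist's `CrossoverBridge`, spelled over `boxZ`: the anchor-connected uniformly zero-free region
reaches arbitrarily large real couplings at SOME points) — the bridge IS the crux's hard core. [folklore] -/
theorem not_crossoverBridge_of_sealedWall (hG : IsCompactSimpleLieGroup G) (r : LatticeRep G)
    {R : Set ℂ} (hRo : IsOpen R) {b : ℝ} (hb : ∀ β : ℝ, b ≤ β → (β : ℂ) ∈ R) {ρ : ℝ} (hρ : 0 < ρ)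
    (hx : ∀ x : ℝ, |x| < ρ → (x : ℂ) ∉ closure R)
    (hW : ∀ z ∈ frontier R, ∀ ε : ℝ, 0 < ε → ∀ L₀ : ℕ, ∃ L : ℕ, L₀ ≤ L ∧ ∀ t₀ : ℕ, ∃ t : ℕ,
      t₀ ≤ t ∧ ∃ w : ℂ, dist w z < ε ∧ boxZ r w L t = 0) :
    ¬ ∀ (G : Type) [Group G] [TopologicalSpace G] [IsTopologicalGroup G] [CompactSpace G]
        [MeasurableSpace G] [BorelSpace G], IsCompactSimpleLieGroup G → ∀ r : LatticeRep G,
        ∀ b ρ : ℝ, 0 < ρ → ∃ β : ℝ, b ≤ β ∧ ∃ D : Set ℂ, IsOpen D ∧ IsConnected D ∧ (β : ℂ) ∈ D ∧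
          (∃ x : ℝ, |x| < ρ ∧ (x : ℂ) ∈ D) ∧
          ∃ L₀ : ℕ, ∀ L : ℕ, L₀ ≤ L → ∃ t₀ : ℕ, ∀ t : ℕ, t₀ ≤ t → ∀ z ∈ D, boxZ r z L t ≠ 0 := by
  intro hB
  obtain ⟨β, hbβ, D, hDo, hDc, hβD, ⟨x, hxρ, hxD⟩, hzf⟩ := hB G hG r b ρ hρ
  obtain ⟨w, hwD, hwf⟩ := exists_mem_frontier_of_isConnected hRo hDc hβD (hb _ hbβ) hxD (hx x hxρ)
  exact not_zeroFree_of_accPt r hDo hwD (hW w hwf) hzf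

end Summit.QuantumFields.YangMills.Theorems.TubeZeroFreeChannel.Negative
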